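import Literature.MathematicalPhysics.QuantumFieldTheory.Balaban1983to89.Node00.OpsYQLetter

/-!
# `Balaban1983to89.B9Eq3115KnitLetterYLocalQ` — [Balaban1985BackgroundPropagators] (3.12)–(3.15) p. 393 («Q … is a local operator») FOR THE KNIT AVERAGING
# LETTER `QknitY` OF RECORD: the law (L2) `IsLocalQ` of `Node00.OpsYQLetter` WITH EXPLICIT DEPENDENCY SETS — the double block `B^j(ι₋) ∪ B^j(ι₊)` of the index bond

T. Bałaban, *Propagators for lattice gauge theories in a background field*, Commun. Math. Phys. **99** (1985) 389–434 [Balaban1985BackgroundPropagators] = [B9]: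
(3.12)–(3.15) p. 393 («Q … is a local operator»), p. 413 («it depends on U restricted to X̃⁵»); T. Bałaban, *Averaging operations for lattice gauge theories*,
Commun. Math. Phys. **98** (1985) 17–51 [Balaban1985Averaging]: p. 24 (the locality sentence after (43)), p. 31 (after (91)).

WHY THIS FILE (seat dag-n06-d g33).  `Node00.OpsYQLetter` records the law (L2) of an averaging letter as `IsLocalQ D 𝔮` for a dependency assignment `D`, and for
the knit letter of record only the trivial instance `isLocalQ_univ` was filed; dag-n06-l's ✓`B9Eq3115KnitLetterYLaws.QknitY_apply_congr` PROVES the genuine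
locality in the periodic reading.  This file names the dependency sets that theorem reads — `knitDepY i ι`, the fine bonds `⟨0 + x, μ⟩` with `x`, `x + e_μ` in the box
`[Lʲz_ι, Lʲz_ι + (Lʲ − 1)𝟙 + Lʲe_κ]` — and packages (L2): ★ `isLocalQ_QknitY : IsLocalQ (knitDepY i) (QknitY i)`, `isLocalQ_qKnitOfRecord`.  Consumer: the locality
row `hOagrA` of the N06 (γ) heads at the bond letter of record (`B9CubeDirInverseBondLocalityY` ∕ `…AtRecordY`: `G_□(U) = G_□(U′)` from (L2) + geometry).

WHAT IS PROVED (sorry-free; standard axioms; bookkeeping over dag-n06-l's theorem; 1 `def` — a `Set`-valued dependency assignment).  Count-neutral; N06 NOT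
discharged; nothing continuum ∕ OS ∕ mass gap ∕ Clay.  NEW file; nothing landed is modified; no `instance`, no `notation`.
-/

noncomputable section

namespace Literature.MathematicalPhysics.QuantumFieldTheory.Balaban1983to89.B9Eq3115KnitLetterYLocalQ

open B7Prop1Explicit renaming Site → LSite
open B7Prop1Explicit (e)
open B7Prop1Local (InBox loK bondHiK)
open B10Eq27TorusAxialLog (transl)
open B6GlobalChartV1 (PV)
open B6KLevelCensusIndexV1 (KIdx)
open B9Eq3115KnitLetterY (zSrc QknitY)
open B9Eq3115KnitLetterYLaws (QknitY_apply_congr)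
open Node00
open Node00.OpsYQLetter (IsLocalQ qKnitOfRecord)
open scoped Matrix.Norms.L2Operator

variable {d ℓ : ℕ} {hd : 1 ≤ d + 1} {hL : Odd (ℓ + 1) ∧ 1 < ℓ + 1} {b₀ b₁ : ℝ}

section Dep

variable (i : KIdx d ℓ hd hL b₀ b₁)

/-- ★ **THE DEPENDENCY SETS OF THE KNIT LETTER**: for an index bond `ι` of level `j`, the fine bonds `⟨0 + x, μ⟩` whose both endpoints `x`, `x + e_μ` lie in the box
`[Lʲz_ι, Lʲz_ι + (Lʲ − 1)𝟙 + Lʲe_κ]` of `ℤ^{d+1}` — the double block `B^j(ι₋) ∪ B^j(ι₊)` read through the periodic lift (exactly the hypothesis domain of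
✓`QknitY_apply_congr`). [cite: Balaban1985Averaging, p.24 (after (43)); Balaban1985BackgroundPropagators, (3.12)–(3.14) p.393, dictionary] -/
def knitDepY (ι : IBondY i) : Set (FBondY i) :=
  {b | ∃ (x : LSite (d + 1)) (μ : Fin (d + 1)),
    InBox (loK (ℓ + 1) (ι.1.1 : ℕ) (zSrc i ι)) (bondHiK (ℓ + 1) (ι.1.1 : ℕ) (zSrc i ι) ι.1.2.dir) x ∧
    InBox (loK (ℓ + 1) (ι.1.1 : ℕ) (zSrc i ι)) (bondHiK (ℓ + 1) (ι.1.1 : ℕ) (zSrc i ι) ι.1.2.dir) (x + e μ) ∧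
    b = ⟨transl (0 : Site (PV d ℓ i.m i.K hd hL) 0) x, μ⟩}

/-- membership of a box bond in the dependency set. [cite: Balaban1985Averaging, p.24, bookkeeping] -/
theorem mem_knitDepY {ι : IBondY i} {x : LSite (d + 1)} {μ : Fin (d + 1)}
    (hx : InBox (loK (ℓ + 1) (ι.1.1 : ℕ) (zSrc i ι)) (bondHiK (ℓ + 1) (ι.1.1 : ℕ) (zSrc i ι) ι.1.2.dir) x)
    (hxe : InBox (loK (ℓ + 1) (ι.1.1 : ℕ) (zSrc i ι)) (bondHiK (ℓ + 1) (ι.1.1 : ℕ) (zSrc i ι) ι.1.2.dir) (x + e μ)) :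
    (⟨transl (0 : Site (PV d ℓ i.m i.K hd hL) 0) x, μ⟩ : FBondY i) ∈ knitDepY i ι :=
  ⟨x, μ, hx, hxe, rfl⟩

end Dep

section Law

variable {𝔸 : Type} [NormedRing 𝔸] [NormOneClass 𝔸] [NormedAlgebra ℂ 𝔸] [CompleteSpace 𝔸]
variable (i : KIdx d ℓ hd hL b₀ b₁)

/-- ★★ **(L2) FOR THE KNIT LETTER WITH ITS DEPENDENCY SETS**: `IsLocalQ (knitDepY i) (QknitY i)` — `(Q(U)a)(ι)` depends on `U` and `a` only through their values on
`knitDepY i ι` (dag-n06-l's ✓`QknitY_apply_congr`, repackaged). [cite: Balaban1985BackgroundPropagators, (3.12)–(3.15) p.393 («Q … is a local operator»); Balaban1985Averaging, p.24] -/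
theorem isLocalQ_QknitY : IsLocalQ (knitDepY i) (QknitY (𝔸 := 𝔸) i) := fun _ _ _ _ ι hU ha =>
  QknitY_apply_congr i ι (fun _ _ hx hxe => hU _ (mem_knitDepY i hx hxe)) (fun _ _ hx hxe => ha _ (mem_knitDepY i hx hxe))

end Law

section Record

variable {N : ℕ} [Nonempty (Fin N)] {θ : Stage3Params}

/-- ★ (L2) for the knit family of record at an index: `IsLocalQ (knitDepY i) (qKnitOfRecord N θ i)`. [cite: Balaban1985BackgroundPropagators, (3.12)–(3.15) p.393; Balaban1985Averaging, p.24] -/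
theorem isLocalQ_qKnitOfRecord (i : KIdx θ.d₆ θ.ℓ₆ θ.hd' θ.hL' θ.b₀ θ.b₁) : IsLocalQ (knitDepY i) (qKnitOfRecord N θ i) :=
  isLocalQ_QknitY i

end Record

end Literature.MathematicalPhysics.QuantumFieldTheory.Balaban1983to89.B9Eq3115KnitLetterYLocalQ

end
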